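import Summits.QuantumFields.BalabanUV.Beta.EriceRemainderEnclosureHistoryAutonomyComparisonAgeCompositionHeatingCriterion
import Summits.QuantumFields.BalabanUV.Beta.EriceRemainderEnclosureHistoryAutonomyComparisonAgeCompositionYoungMass

/-!
# EriceRemainderEnclosureHistoryAutonomyComparisonAgeCompositionHeatingCriterionFlow — (E116b) route (N), first order: THE HEATING OF A ROW IS A BUDGET
# STATEMENT, and THE EVERY-RANGE END UNDER A LEVEL-GAUGE HARNACK HYPOTHESIS.  Along every admissible flow (isotone memory `B` with floor `b > 0` dominating
# `Σ_k L_k·u_k`, box solution `h`, levels `a_n = 1∕h(n)²`) and for EVERY sub-profile (any finite set `O` of loaded ages `< K`, undamped tail-sum kernel):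
# (i) THE DECAY OF A RATE IS PAID FROM THE BUDGET: `L_kh(m+k)³∕2 − L_kh(m+1+k)³∕2 ≤ (3∕4)·β_k(m+1)·Δa_{m+k+1}·h(m+k)⁴` with the SHARE `β_k(m+1) = L_kh(m+1+k)`
# of the row-`(m+1)` budget `Σ_k β_k(m+1) ≤ Δa_{m+1}` (**`rate_decay_le`**, **`flow_rate_decay_le`**, **`flow_budget_le`**); the levels are concave, so
# `(k−1)·Δa_{m+k+1} ≤ a_{m+k} − a_{m+1}` (**`flow_window_rise_ge`**) — the heating of age `k` at the row `m` is at most `(3∕4)·β_k(m+1)·(window average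
# of ε)·(a_{m+k} − a_{m+1})∕a_{m+k}²`: IT WEIGHS ONLY WHERE THE LEVEL DOUBLES ACROSS THE WINDOW (`r(1−r) ≤ 1∕4`, `r = a_{m+1}∕a_{m+k}`); (ii) a rate decays at
# least like its own square, `(L_kh(m+k)³∕2)² ≤ [h(m+k)³∕(2h(m+1+k)²h(m+2k+1))]·(L_kh(m+k)³∕2 − L_kh(m+1+k)³∕2)` (**`flow_rate_sq_le_decay`**: a heavy age
# decays fast — the mechanism behind the observed MONOTONICITY of ε in the depth, README §4); (iii) **`flow_nonneg_of_level_harnack` — THE END AT EVERY RANGE,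
# EVERY FLOW, EVERY SUB-PROFILE, EVERY HORIZON AND TRUNCATION, CONDITIONAL ON ONE INEQUALITY**: if the solution of `ε = 1_{[0,J]} − R ε` obeys the
# LEVEL-GAUGE HARNACK BOUND `ε(m+1+l) ≤ H_{m,k}·(a_{m+1+l}∕a_{m+1})·ε(m+1)` on the interior of every loaded window below every row (`k ∈ O`, `1 ≤ l < k`,
# `m+1+l ≤ J`) with constants fitting the row's budget, `(3∕4)·h(m+1)²·Σ_k H_{m,k}·β_k(m+1)·(1 − a_{m+1}∕a_{m+k}) + F(m) ≤ 1` (`F(m) = Σ_k L_kh(m+k)³∕2` the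
# first entry), then `0 ≤ ε ≤ 1` at every depth.  By (E116a) `sol_nonneg_iff_heating_le` this is the row induction «heating ≤ persistence + outflow»; the
# outflow is only used through its sign.  README `HOME/b2b-balaban-beta-d4-p2/g97/README.md` §3: on every admissible configuration computed (LP maximisers,
# towers, young clusters, 186 capped-LP∕spread families, and an adversarial hill-climb over concave flows and profiles with the sharpest constants
# `H_{m,k} = max_l ε(m+1+l)a_{m+1}∕(a_{m+1+l}ε(m+1))`) the left side of (FIT) is ≤ 0.71 = √2∕2 — the value of the lone age `1` at full load, which has NO
# heating: the heating term never lifts (FIT) above the first entry's own maximum (kit g97lab4 j343638); ε is NON-DECREASING in the depth on everything computed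
# and its Harnack constant over a level-doubling window is ≤ 1.31.  What the hypothesis asks of the flow is the growth of ε with the LEVEL below a pin,
# `ε(n)∕ε(m+1) ≲ a_n∕a_{m+1}`, allowed to fail by the factor `H_{m,k} ≈ (4∕3)(1 − F)·a_{m+1}∕Δa_{m+1}` — a constraint only at the infrared rows.

Cell `pub-balaban`, β-function sub-cell, BINDER row D4 «RemainderConst leaves for Bałaban's split» (`HOME/BINDER-OWNERS.md`; owner lineage `b2b-balaban-beta-an4`;
this file by co-owner #2 lineage `b2b-balaban-beta-d4-p2`, generation 97), β-FLOW TEAM duty (1), FREEZE (0) honoured (def-free; imports (E116a) `…HeatingCriterion`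
and (E115f) `…YoungMass`; uses (E116a) `sol_mem_Icc_of_rowwise`, (E115f) `old_kernel_facts`, (E71a) `sol_eq_zero_of_tail`, (E58b) `increment_anti`, (E48a)
`strictAnti_of_memFlow`, node U2's `MemFlow` ∕ `SeqBox` ∕ `seqBox_shift` BY NAME; nothing restated).

HONEST FRAMING (page 1, verbatim and binding).  *"Discharging BetaPertH makes Bałaban's UV stability UNCONDITIONAL — a real constructive-QFT result; it is
NOT the continuum limit and NOT the Clay problem."*  THIS FILE DISCHARGES NOTHING OF THE KIND.  Elementary real analysis about ABSTRACT functionals on a box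
]0,γ]^ℕ with displayed floors, profiles and signs, and the FIRST-ORDER renewal objects of route (N) built from them — hypotheses of a census, not facts; the
form, signs, ages and moments of Bałaban's (1.22) limit functional are NOT PRINTED ([I] p. 298; GAPS G-t4-U2-1∕-2) and NOT asserted.  Row D4 class
UNCHANGED (critical-path width 0; instance 0∕1; D4 DISCHARGE NO DATE).  HONEST DEPENDENCY: continuum YM on T⁴ ⇐ BetaPertH ∧ nine spine estimates (0/9
proved); BetaPertH ⇐ (D1) ∧ (D4) ∧ CAP+tail; G-an2-4 gates asym, D1 and NE2/3/4.

NOT CLAIMED: the Harnack hypothesis for any flow (it is the open part, README g97 §5); the END beyond the tree's classes; anything printed — NOT B12 Thm 2, NOT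
BetaPertH, NOT continuum, NOT Clay.

WHAT IS PROVED ([folklore]; 0 `def`, 0 sorry).  §1 **`rate_decay_le`**, `age_heating_le`.  §2 **`flow_budget_le`**, **`flow_rate_decay_le`**, `flow_incr_mul_le_rise`,
**`flow_window_rise_ge`**, **`flow_rate_sq_le_decay`**.  §3 **`flow_nonneg_of_level_harnack`**.
-/
noncomputable section
open Finset

namespace Summit.QuantumFields.BalabanUV.Beta.EriceRemainderEnclosureHistoryAutonomyComparisonAgeCompositionHeatingCriterionFlow

open Literature.MathematicalPhysics.QuantumFieldTheory.Balaban1983to89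
open Literature.MathematicalPhysics.QuantumFieldTheory.Balaban1983to89.T4BetaStationary
open Literature.MathematicalPhysics.QuantumFieldTheory.Balaban1983to89.T4BetaFlowWellPosed
open Summit.QuantumFields.BalabanUV.Beta.EriceRemainderEnclosureHistoryAutonomyComparisonAgeComposition (sol_eq_zero_of_tail)
open Summit.QuantumFields.BalabanUV.Beta.EriceRemainderEnclosureHistoryAutonomyComparisonAgeCompositionHeatingCriterion (sol_mem_Icc_of_rowwise)
open Summit.QuantumFields.BalabanUV.Beta.EriceRemainderEnclosureHistoryAutonomyComparisonAgeCompositionYoungMass (old_kernel_facts)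
open Summit.QuantumFields.BalabanUV.Beta.EriceRemainderEnclosureHistoryAutonomyComparisonAffineProfile (increment_anti)
open Summit.QuantumFields.BalabanUV.Beta.EriceRemainderEnclosureHistoryAutonomyOrder (strictAnti_of_memFlow)

/-! ## §1 Real arithmetic: the decay of a cubic rate, and the per-age heating algebra -/

/-- **THE DECAY OF A CUBIC RATE.**  For `0 < y ≤ x`:  `x³∕2 − y³∕2 ≤ (3∕4)·y·(1∕y² − 1∕x²)·x⁴`  (equivalently `3x⁴ − 2x³y − 3x²y² + 2y⁴ = (x−y)²(3x² + 4xy + 2y²) ≥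
0`).  With `x = h(m+k)`, `y = h(m+1+k)`: the decay of the rate `L_kh³∕2` across one row is at most `(3∕4)·(L_ky)·Δa·x⁴`, the budget share of the next row
times the level increment. [folklore] -/
theorem rate_decay_le {x y : ℝ} (hy : 0 < y) (hyx : y ≤ x) :
    x ^ 3 / 2 - y ^ 3 / 2 ≤ 3 / 4 * y * (1 / y ^ 2 - 1 / x ^ 2) * x ^ 4 := by
  have hx : 0 < x := hy.trans_le hyx
  have key : 0 ≤ (x - y) ^ 2 * (3 * x ^ 2 + 4 * x * y + 2 * y ^ 2) := by positivity
  have e : 3 / 4 * y * (1 / y ^ 2 - 1 / x ^ 2) * x ^ 4 - (x ^ 3 / 2 - y ^ 3 / 2)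
      = (x - y) ^ 2 * (3 * x ^ 2 + 4 * x * y + 2 * y ^ 2) / (4 * y) := by
    field_simp
    ring
  have : 0 ≤ (x - y) ^ 2 * (3 * x ^ 2 + 4 * x * y + 2 * y ^ 2) / (4 * y) := div_nonneg key (by positivity)
  linarith

/-- **THE HEATING OF ONE AGE (algebra).**  Decay `d ≤ (3∕4)·β·Δ·hk⁴`, interior window sum `W ≤ (k−1)·H·(h1²∕hk²)·ε1`, concavity `(k−1)·Δ ≤ 1∕hk² − 1∕h1²`,
`W, β, Δ, H, ε1 ≥ 0` ⟹ `d·W ≤ (3∕4)·h1²·(H·β·(1 − hk²∕h1²))·ε1`. [folklore] -/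
theorem age_heating_le {d W β Δ hk h1 H ε1 κ : ℝ} (hW0 : 0 ≤ W) (hβ : 0 ≤ β) (hΔ : 0 ≤ Δ) (hhk : 0 < hk) (hh1 : 0 < h1)
    (hH : 0 ≤ H) (hε1 : 0 ≤ ε1)
    (hd : d ≤ 3 / 4 * β * Δ * hk ^ 4) (hW : W ≤ κ * H * (h1 ^ 2 / hk ^ 2) * ε1) (hrise : κ * Δ ≤ 1 / hk ^ 2 - 1 / h1 ^ 2) :
    d * W ≤ 3 / 4 * h1 ^ 2 * (H * β * (1 - hk ^ 2 / h1 ^ 2)) * ε1 := by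
  have h1' : d * W ≤ (3 / 4 * β * Δ * hk ^ 4) * (κ * H * (h1 ^ 2 / hk ^ 2) * ε1) :=
    mul_le_mul hd hW hW0 (by positivity)
  have e1 : (3 / 4 * β * Δ * hk ^ 4) * (κ * H * (h1 ^ 2 / hk ^ 2) * ε1) = 3 / 4 * β * H * ε1 * h1 ^ 2 * hk ^ 2 * (κ * Δ) := by
    field_simp
  have h2 : 3 / 4 * β * H * ε1 * h1 ^ 2 * hk ^ 2 * (κ * Δ) ≤ 3 / 4 * β * H * ε1 * h1 ^ 2 * hk ^ 2 * (1 / hk ^ 2 - 1 / h1 ^ 2) :=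
    mul_le_mul_of_nonneg_left hrise (by positivity)
  have e2 : 3 / 4 * β * H * ε1 * h1 ^ 2 * hk ^ 2 * (1 / hk ^ 2 - 1 / h1 ^ 2) = 3 / 4 * h1 ^ 2 * (H * β * (1 - hk ^ 2 / h1 ^ 2)) * ε1 := by
    field_simp
  linarith

/-! ## §2 Along the flow: budget, decay, window rise, decay ≥ square -/

variable {B : (ℕ → ℝ) → ℝ} {γ b gIR : ℝ} {L : ℕ → ℝ} {K : ℕ} {h : ℕ → ℝ}

/-- **THE ROW BUDGET** (domination + the flow step): `Σ_{k<K} L_kh(m+1+k) ≤ 1∕h(m+1)² − 1∕h(m)² = Δa_{m+1}`. [folklore] -/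
theorem flow_budget_le (hdom : ∀ u, SeqBox γ u → ∑ k ∈ range K, L k * u k ≤ B u) (hh : SeqBox γ h) (hf : MemFlow B gIR h) (m : ℕ) :
    ∑ k ∈ range K, L k * h (m + 1 + k) ≤ 1 / h (m + 1) ^ 2 - 1 / h m ^ 2 := by
  have := hdom _ (seqBox_shift hh (m + 1))
  rw [hf.2 m]
  linarith

/-- **THE DECAY OF A RATE IS PAID FROM THE NEXT ROW'S BUDGET**: `L_kh(m+k)³∕2 − L_kh(m+1+k)³∕2 ≤ (3∕4)·(L_kh(m+1+k))·(1∕h(m+1+k)² − 1∕h(m+k)²)·h(m+k)⁴`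
(`rate_decay_le` with the trajectory decreasing, `L_k ≥ 0`). [folklore] -/
theorem flow_rate_decay_le (hL : ∀ k, 0 ≤ L k) (hb : 0 < b) (hlo : ∀ u, SeqBox γ u → b ≤ B u) (hh : SeqBox γ h) (hf : MemFlow B gIR h)
    (k m : ℕ) :
    L k * h (m + k) ^ 3 / 2 - L k * h (m + 1 + k) ^ 3 / 2
      ≤ 3 / 4 * (L k * h (m + 1 + k)) * (1 / h (m + 1 + k) ^ 2 - 1 / h (m + k) ^ 2) * h (m + k) ^ 4 := by
  have hpos : ∀ j, 0 < h j := fun j => (hh j).1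
  have hanti := (strictAnti_of_memFlow hb hlo hh hf).antitone
  have hle : h (m + 1 + k) ≤ h (m + k) := hanti (by omega)
  have h1 := rate_decay_le (hpos (m + 1 + k)) hle
  have h2 := mul_le_mul_of_nonneg_left h1 (hL k)
  have e1 : L k * (h (m + k) ^ 3 / 2 - h (m + 1 + k) ^ 3 / 2) = L k * h (m + k) ^ 3 / 2 - L k * h (m + 1 + k) ^ 3 / 2 := by ring
  have e2 : L k * (3 / 4 * h (m + 1 + k) * (1 / h (m + 1 + k) ^ 2 - 1 / h (m + k) ^ 2) * h (m + k) ^ 4)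
      = 3 / 4 * (L k * h (m + 1 + k)) * (1 / h (m + 1 + k) ^ 2 - 1 / h (m + k) ^ 2) * h (m + k) ^ 4 := by ring
  rw [e1, e2] at h2
  exact h2

/-- **CONCAVITY OF THE LEVELS, SUMMED**: `j·(1∕h(n+j+1)² − 1∕h(n+j)²) ≤ 1∕h(n+j)² − 1∕h(n)²` — each of the `j` increments of `[n, n+j)` is at least the
increment at `n+j` ((E58b) `increment_anti`). [folklore] -/
theorem flow_incr_mul_le_rise (hmono : ∀ u v : ℕ → ℝ, SeqBox γ u → SeqBox γ v → (∀ j, u j ≤ v j) → B u ≤ B v) (hb : 0 < b)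
    (hlo : ∀ u, SeqBox γ u → b ≤ B u) (hh : SeqBox γ h) (hf : MemFlow B gIR h) (n : ℕ) :
    ∀ j : ℕ, (j : ℝ) * (1 / h (n + j + 1) ^ 2 - 1 / h (n + j) ^ 2) ≤ 1 / h (n + j) ^ 2 - 1 / h n ^ 2 := by
  intro j
  induction j with
  | zero => simp
  | succ j ih =>
    have hstep1 : 1 / h (n + j + 1) ^ 2 - 1 / h (n + j) ^ 2 = B (fun i => h (n + j + 1 + i)) := by
      rw [hf.2 (n + j)]; ring
    have hstep2 : 1 / h (n + (j + 1) + 1) ^ 2 - 1 / h (n + (j + 1)) ^ 2 = B (fun i => h (n + j + 1 + 1 + i)) := by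
      rw [show n + (j + 1) + 1 = (n + j + 1) + 1 by ring, show n + (j + 1) = n + j + 1 by ring, hf.2 (n + j + 1)]; ring
    have hanti : B (fun i => h (n + j + 1 + 1 + i)) ≤ B (fun i => h (n + j + 1 + i)) := increment_anti hmono hb hlo hh hf (by omega)
    rw [hstep2, show n + (j + 1) = n + j + 1 by ring]
    rw [hstep1] at ih
    push_cast
    have : 1 / h (n + j + 1) ^ 2 - 1 / h n ^ 2 = (1 / h (n + j) ^ 2 - 1 / h n ^ 2) + B (fun i => h (n + j + 1 + i)) := by
      rw [hf.2 (n + j)]; ring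
    rw [this]
    nlinarith

/-- **THE RISE ACROSS A WINDOW DOMINATES `(k−1)` LATE INCREMENTS**: `(k−1)·(1∕h(m+1+k)² − 1∕h(m+k)²) ≤ 1∕h(m+k)² − 1∕h(m+1)²` for `k ≥ 1`, i.e.
`(k−1)·Δa_{m+k+1} ≤ a_{m+k} − a_{m+1}`. [folklore] -/
theorem flow_window_rise_ge (hmono : ∀ u v : ℕ → ℝ, SeqBox γ u → SeqBox γ v → (∀ j, u j ≤ v j) → B u ≤ B v) (hb : 0 < b)
    (hlo : ∀ u, SeqBox γ u → b ≤ B u) (hh : SeqBox γ h) (hf : MemFlow B gIR h) (m : ℕ) {k : ℕ} (hk : 1 ≤ k) :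
    ((k : ℝ) - 1) * (1 / h (m + 1 + k) ^ 2 - 1 / h (m + k) ^ 2) ≤ 1 / h (m + k) ^ 2 - 1 / h (m + 1) ^ 2 := by
  obtain ⟨j, rfl⟩ : ∃ j, k = j + 1 := ⟨k - 1, by omega⟩
  have := flow_incr_mul_le_rise hmono hb hlo hh hf (m + 1) j
  rw [show m + 1 + j + 1 = m + 1 + (j + 1) by ring, show m + 1 + j = m + (j + 1) by ring] at this
  push_cast
  linarith

/-- **A RATE DECAYS AT LEAST LIKE ITS OWN SQUARE.**  For a loaded age `k < K` at any pin `m`: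
`(L_kh(m+k)³∕2)² ≤ [h(m+k)³ ∕ (2·h(m+1+k)²·h(m+2k+1))]·(L_kh(m+k)³∕2 − L_kh(m+1+k)³∕2)` — the rate is at most its budget share at the row `m+k+1`
(`L_kh(m+2k+1) ≤ Δa_{m+k+1}`, domination with every other age dropped) times `h(m+k)³∕(2h(m+2k+1))`, and the decay is at least the rate times
`Δa_{m+k+1}·h(m+1+k)²`.  The bracket is `(1∕2)(a_{m+1+k}∕a_{m+k})·(a_{m+2k+1}∕a_{m+k})^{1∕2}·a_{m+k}^{…}`-free: `≤ √3` always, `→ √2∕2` deep; so a HEAVY age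
decays FAST (README g97 §4: the mechanism excluding the renewal bounce — ε is monotone in the depth on everything computed). [folklore] -/
theorem flow_rate_sq_le_decay (hL : ∀ k, 0 ≤ L k) (hb : 0 < b) (hlo : ∀ u, SeqBox γ u → b ≤ B u)
    (hdom : ∀ u, SeqBox γ u → ∑ k ∈ range K, L k * u k ≤ B u) (hh : SeqBox γ h) (hf : MemFlow B gIR h) {k : ℕ} (hkK : k < K) (m : ℕ) :
    (L k * h (m + k) ^ 3 / 2) ^ 2
      ≤ h (m + k) ^ 3 / (2 * h (m + 1 + k) ^ 2 * h (m + 2 * k + 1)) * (L k * h (m + k) ^ 3 / 2 - L k * h (m + 1 + k) ^ 3 / 2) := by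
  have hpos : ∀ j, 0 < h j := fun j => (hh j).1
  have hanti := (strictAnti_of_memFlow hb hlo hh hf).antitone
  have h0 := hpos (m + k); have h1 := hpos (m + 1 + k); have h2 := hpos (m + 2 * k + 1)
  have hLk := hL k
  -- the budget share at the row m+k+1: L_k h(m+2k+1) ≤ Δa_{m+k+1} = 1/h(m+1+k)² − 1/h(m+k)²
  have hbud : L k * h (m + 2 * k + 1) ≤ 1 / h (m + 1 + k) ^ 2 - 1 / h (m + k) ^ 2 := by
    have hb' := flow_budget_le hdom hh hf (m + k)
    have hsingle : L k * h (m + k + 1 + k) ≤ ∑ i ∈ range K, L i * h (m + k + 1 + i) :=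
      single_le_sum (f := fun i => L i * h (m + k + 1 + i)) (fun i _ => mul_nonneg (hL i) (hpos _).le) (mem_range.mpr hkK)
    rw [show m + k + 1 + k = m + 2 * k + 1 by ring] at hsingle
    rw [show m + k + 1 = m + 1 + k by ring] at hb' hsingle
    exact hsingle.trans hb'
  -- the decay is at least rate × Δa × h(m+1+k)²:  x³ − y³ ≥ x³ (1 − y²/x²) = x (x² − y²)  [y ≤ x]
  have hle : h (m + 1 + k) ≤ h (m + k) := hanti (by omega)
  set x := h (m + k) with hx
  set y := h (m + 1 + k) with hy
  set z := h (m + 2 * k + 1) with hz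
  have hdec : L k * x ^ 3 / 2 * ((1 / y ^ 2 - 1 / x ^ 2) * y ^ 2) ≤ L k * x ^ 3 / 2 - L k * y ^ 3 / 2 := by
    have e : L k * x ^ 3 / 2 * ((1 / y ^ 2 - 1 / x ^ 2) * y ^ 2) = L k / 2 * (x ^ 3 - x * y ^ 2) := by field_simp
    rw [e]
    have : x * y ^ 2 ≥ y ^ 3 := by nlinarith [pow_pos h1 2]
    nlinarith
  -- combine: (L x³/2)² = (L x³/2)·(L z)·x³/(2z) ≤ (L x³/2)·Δa·x³/(2z) and Δa ≤ decay/(rate·y²)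
  have hrate0 : 0 ≤ L k * x ^ 3 / 2 := by positivity
  have hΔ0 : 0 ≤ 1 / y ^ 2 - 1 / x ^ 2 := by
    have := one_div_le_one_div_of_le (pow_pos h1 2) (pow_le_pow_left₀ h1.le hle 2)
    linarith
  calc (L k * x ^ 3 / 2) ^ 2 = (L k * x ^ 3 / 2) * (L k * z) * (x ^ 3 / (2 * z)) := by field_simp
    _ ≤ (L k * x ^ 3 / 2) * (1 / y ^ 2 - 1 / x ^ 2) * (x ^ 3 / (2 * z)) := by
        have := mul_le_mul_of_nonneg_left hbud hrate0
        exact mul_le_mul_of_nonneg_right this (by positivity)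
    _ = x ^ 3 / (2 * y ^ 2 * z) * (L k * x ^ 3 / 2 * ((1 / y ^ 2 - 1 / x ^ 2) * y ^ 2)) := by field_simp
    _ ≤ x ^ 3 / (2 * y ^ 2 * z) * (L k * x ^ 3 / 2 - L k * y ^ 3 / 2) := mul_le_mul_of_nonneg_left hdec (by positivity)

/-! ## §3 The every-range END under a level-gauge Harnack hypothesis -/

/-- **THE END AT EVERY RANGE UNDER A LEVEL-GAUGE HARNACK HYPOTHESIS.**  `B` isotone with floor `b > 0` dominating `L ≥ 0` on the ages `< K`; `h` a box
solution; `O` ANY finite set of loaded ages with the undamped tail-sum kernel `K m l = Σ_{k∈(l,K)} w_O k m`, `w_O k m = [k ∈ O]·L_kh(m+k)³∕2`; horizon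
`N ≥ K`, `N ≥ 1`; `ε` the zero-tailed solution of `ε = 1_{[0,J]} − R ε`, `J ≤ N`.  HYPOTHESES ON THE SOLUTION: (HARNACK, level gauge) for every row `m`,
every loaded age `k ∈ O` and every interior lag `1 ≤ l < k` with `m+1+l ≤ J`:  `ε(m+1+l) ≤ H_{m,k}·(h(m+1)²∕h(m+1+l)²)·ε(m+1)` (`= H_{m,k}·(a_{m+1+l}∕a_{m+1})·
ε(m+1)`), with `H ≥ 0`; (FIT) at every row `m < J`:  `(3∕4)·h(m+1)²·Σ_{k∈[1,K)} [k∈O]·H_{m,k}·L_kh(m+1+k)·(1 − h(m+k)²∕h(m+1)²) + Σ_{k∈[1,K)} w_O k m ≤ 1`.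
CONCLUSION: `0 ≤ ε ≤ 1` at every depth.  PROOF: (E116a) `sol_mem_Icc_of_rowwise`; at a row `m < J` the heating of age `k` is `≤ (3∕4)h(m+1)²·H_{m,k}β_k(m+1)
(1 − a_{m+1}∕a_{m+k})·ε(m+1)` by `flow_rate_decay_le` + the hypothesis + `flow_window_rise_ge` (`age_heating_le`), the outflow is `≥ 0` by positivity below,
and (FIT) closes the row; rows `m ≥ J` see only zeros.  The weight `β_k(m+1)(1 − a_{m+1}∕a_{m+k}) ≤ β_k(m+1)` sums to at most the budget `Δa_{m+1}`
(`flow_budget_le`), so (FIT) holds as soon as `sup_k H_{m,k} ≤ (4∕3)(1 − F(m))·a_{m+1}∕Δa_{m+1}` — a constraint only at the infrared rows. [folklore] -/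
theorem flow_nonneg_of_level_harnack (hmono : ∀ u v : ℕ → ℝ, SeqBox γ u → SeqBox γ v → (∀ j, u j ≤ v j) → B u ≤ B v)
    (hL : ∀ k, 0 ≤ L k) (hb : 0 < b) (hlo : ∀ u, SeqBox γ u → b ≤ B u)
    (hh : SeqBox γ h) (hf : MemFlow B gIR h) (O : Finset ℕ)
    {wO : ℕ → ℕ → ℝ} (hwO : ∀ k m, wO k m = if k ∈ O then L k * h (m + k) ^ 3 / 2 else 0)
    {N : ℕ} (hN : 1 ≤ N) (hKN : K ≤ N) {KO : ℕ → ℕ → ℝ} (hKO : ∀ m l, KO m l = ∑ k ∈ Ico (l + 1) K, wO k m)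
    {R : (ℕ → ℝ) → ℕ → ℝ} (hR : ∀ u m, R u m = ∑ l ∈ range N, KO m l * u (m + 1 + l))
    {J : ℕ} (hJN : J ≤ N) {ε : ℕ → ℝ} (hεt : ∀ m, N < m → ε m = 0)
    (hεrec : ∀ m, ε m = (fun n => if n ≤ J then (1 : ℝ) else 0) m - R ε m)
    {H : ℕ → ℕ → ℝ} (hH0 : ∀ m k, 0 ≤ H m k)
    (hH : ∀ m k l, k ∈ O → 1 ≤ l → l < k → m + 1 + l ≤ J → ε (m + 1 + l) ≤ H m k * (h (m + 1) ^ 2 / h (m + 1 + l) ^ 2) * ε (m + 1))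
    (hfit : ∀ m, m < J →
      3 / 4 * h (m + 1) ^ 2 * ∑ k ∈ Ico 1 K, (if k ∈ O then H m k * (L k * h (m + 1 + k)) * (1 - h (m + k) ^ 2 / h (m + 1) ^ 2) else 0)
        + ∑ k ∈ Ico 1 K, wO k m ≤ 1) :
    ∀ m, 0 ≤ ε m ∧ ε m ≤ 1 := by
  set e : ℕ → ℝ := fun n => if n ≤ J then (1 : ℝ) else 0 with he_def
  have hpos : ∀ j, 0 < h j := fun j => (hh j).1
  have hanti := (strictAnti_of_memFlow hb hlo hh hf).antitone
  obtain ⟨hw0, hwmono⟩ := old_kernel_facts hL hb hlo hh hf O hwO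
  -- values of the excess
  have he_le : ∀ n, e (n + 1) ≤ e n := fun n => by
    simp only [he_def]; split_ifs <;> first | exact le_rfl | exact zero_le_one | omega
  have he1 : ∀ n, e n ≤ 1 := fun n => by simp only [he_def]; split_ifs <;> norm_num
  -- support of the solution beyond J
  have het : ∀ n, N < n + (N - J) → e n = 0 := fun n hn => if_neg (show ¬ n ≤ J by omega)
  have hεJ : ∀ n, J < n → ε n = 0 := fun n hn => sol_eq_zero_of_tail hR hεt hεrec het n (by omega)
  -- the row criterion
  have hmain := sol_mem_Icc_of_rowwise (A := K) (e := e) hR hKO hN hw0 hεrec hεt ?_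
  · intro m; exact ⟨(hmain m).1, (hmain m).2.trans (he1 m)⟩
  intro m hbelow
  by_cases hmJ : m < J
  · -- inside: Δe = 0, outflow ≥ 0, heating ≤ (3/4) h(m+1)² S(m) ε(m+1) ≤ (1 − F m) ε(m+1)
    have hem : e m - e (m + 1) = 0 := by
      simp only [he_def]; rw [if_pos (by omega), if_pos (by omega)]; ring
    have hε1 : 0 ≤ ε (m + 1) := hbelow (m + 1) (by omega)
    have hout : 0 ≤ ∑ k ∈ Ico 1 K, wO k (m + 1) * ε (m + 1 + min k N) :=
      sum_nonneg fun k _ => mul_nonneg (hw0 k (m + 1)) (hbelow _ (by omega))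
    have hheat : ∑ k ∈ Ico 1 K, (wO k m - wO k (m + 1)) * ∑ l ∈ Ico 1 (min k N), ε (m + 1 + l)
        ≤ ∑ k ∈ Ico 1 K, 3 / 4 * h (m + 1) ^ 2
            * (if k ∈ O then H m k * (L k * h (m + 1 + k)) * (1 - h (m + k) ^ 2 / h (m + 1) ^ 2) else 0) * ε (m + 1) := by
      refine sum_le_sum fun k hk => ?_
      have hk1 : 1 ≤ k := (mem_Ico.mp hk).1
      have hkK : k < K := (mem_Ico.mp hk).2
      have hmin : min k N = k := min_eq_left (by omega)
      rw [hmin]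
      by_cases hkO : k ∈ O
      · rw [if_pos hkO]
        have hwm : wO k m = L k * h (m + k) ^ 3 / 2 := by rw [hwO, if_pos hkO]
        have hwm1 : wO k (m + 1) = L k * h (m + 1 + k) ^ 3 / 2 := by rw [hwO, if_pos hkO]
        -- decay
        have hd : wO k m - wO k (m + 1) ≤ 3 / 4 * (L k * h (m + 1 + k)) * (1 / h (m + 1 + k) ^ 2 - 1 / h (m + k) ^ 2) * h (m + k) ^ 4 := by
          rw [hwm, hwm1]; exact flow_rate_decay_le hL hb hlo hh hf k m
        -- window
        have hW0 : 0 ≤ ∑ l ∈ Ico 1 k, ε (m + 1 + l) := sum_nonneg fun l hl => hbelow _ (by omega)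
        have hWle : ∑ l ∈ Ico 1 k, ε (m + 1 + l) ≤ ((k : ℝ) - 1) * H m k * (h (m + 1) ^ 2 / h (m + k) ^ 2) * ε (m + 1) := by
          have hpt : ∀ l ∈ Ico 1 k, ε (m + 1 + l) ≤ H m k * (h (m + 1) ^ 2 / h (m + k) ^ 2) * ε (m + 1) := by
            intro l hl
            have hl1 : 1 ≤ l := (mem_Ico.mp hl).1
            have hlk : l < k := (mem_Ico.mp hl).2
            by_cases hlJ : m + 1 + l ≤ J
            · have h1 := hH m k l hkO hl1 hlk hlJ
              have hratio : h (m + 1) ^ 2 / h (m + 1 + l) ^ 2 ≤ h (m + 1) ^ 2 / h (m + k) ^ 2 := by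
                have hkl : h (m + k) ≤ h (m + 1 + l) := hanti (by omega)
                exact div_le_div_of_nonneg_left (by positivity) (by have := hpos (m + k); positivity)
                  (pow_le_pow_left₀ (hpos (m + k)).le hkl 2)
              have h2 : H m k * (h (m + 1) ^ 2 / h (m + 1 + l) ^ 2) * ε (m + 1) ≤ H m k * (h (m + 1) ^ 2 / h (m + k) ^ 2) * ε (m + 1) :=
                mul_le_mul_of_nonneg_right (mul_le_mul_of_nonneg_left hratio (hH0 m k)) hε1
              exact h1.trans h2
            · rw [hεJ (m + 1 + l) (by omega)]
              have := hH0 m k; have := hpos (m + 1); have := hpos (m + k); positivity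
          calc ∑ l ∈ Ico 1 k, ε (m + 1 + l) ≤ ∑ l ∈ Ico 1 k, H m k * (h (m + 1) ^ 2 / h (m + k) ^ 2) * ε (m + 1) := sum_le_sum hpt
            _ = ((k : ℝ) - 1) * H m k * (h (m + 1) ^ 2 / h (m + k) ^ 2) * ε (m + 1) := by
                rw [sum_const, Nat.card_Ico, nsmul_eq_mul]
                have : ((k - 1 : ℕ) : ℝ) = (k : ℝ) - 1 := by rw [Nat.cast_sub hk1]; simp
                rw [this]; ring
        -- rise
        have hrise := flow_window_rise_ge hmono hb hlo hh hf m hk1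
        have hΔ0 : 0 ≤ 1 / h (m + 1 + k) ^ 2 - 1 / h (m + k) ^ 2 := by
          have hkl : h (m + 1 + k) ≤ h (m + k) := hanti (by omega)
          have := one_div_le_one_div_of_le (pow_pos (hpos (m + 1 + k)) 2) (pow_le_pow_left₀ (hpos (m + 1 + k)).le hkl 2)
          linarith
        have hβ0 : 0 ≤ L k * h (m + 1 + k) := mul_nonneg (hL k) (hpos _).le
        have := age_heating_le hW0 hβ0 hΔ0 (hpos (m + k)) (hpos (m + 1)) (hH0 m k) hε1 hd hWle hrise
        linarith
      · rw [if_neg hkO]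
        have hwm : wO k m = 0 := by rw [hwO, if_neg hkO]
        have hwm1 : wO k (m + 1) = 0 := by rw [hwO, if_neg hkO]
        rw [hwm, hwm1]; simp
    rw [← sum_mul, ← mul_sum] at hheat
    have hfit' := hfit m hmJ
    have hF : 3 / 4 * h (m + 1) ^ 2
        * (∑ k ∈ Ico 1 K, (if k ∈ O then H m k * (L k * h (m + 1 + k)) * (1 - h (m + k) ^ 2 / h (m + 1) ^ 2) else 0)) * ε (m + 1)
        ≤ (1 - ∑ k ∈ Ico 1 K, wO k m) * ε (m + 1) := mul_le_mul_of_nonneg_right (by linarith) hε1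
    rw [hem]
    linarith
  · -- at and beyond the truncation: every value read is zero
    have hz : ∀ l, ε (m + 1 + l) = 0 := fun l => hεJ _ (by omega)
    have h1 : ∑ k ∈ Ico 1 K, (wO k m - wO k (m + 1)) * ∑ l ∈ Ico 1 (min k N), ε (m + 1 + l) = 0 :=
      sum_eq_zero fun k _ => by rw [sum_eq_zero fun l _ => hz l, mul_zero]
    have h2 : ∑ k ∈ Ico 1 K, wO k (m + 1) * ε (m + 1 + min k N) = 0 := sum_eq_zero fun k _ => by rw [hz, mul_zero]
    have h3 : ε (m + 1) = 0 := by have := hz 0; simpa using this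
    rw [h1, h2, h3, mul_zero, add_zero, add_zero]
    linarith [he_le m]

end Summit.QuantumFields.BalabanUV.Beta.EriceRemainderEnclosureHistoryAutonomyComparisonAgeCompositionHeatingCriterionFlow

end
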